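import Literature.Topology.FourManifolds.MMSWRasmussenFacts
import Literature.Topology.FourManifolds.UnorientedDiscTheorem
import Literature.Topology.FourManifolds.BallStretch
import Literature.Topology.FourManifolds.SliceDiscInTransport
import Literature.Topology.FourManifolds.HomotopyBallSliceSphereProofs
import Literature.Topology.FourManifolds.MilnorLocalEmbeddingGlobalization
import Literature.Topology.FourManifolds.KnotFraming
import Summits.SmoothPoincare4.SmoothPoincare4.Theses.DottedCircleRasmussen

/-!
# SmoothPoincare4 / DottedCircleRasmussen — the GFGMW lemma (item stmt-SmoothPoincare4-16153, `DcrGfgmw`)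

The support item `DcrGfgmw` of route `DottedCircleRasmussen` is the generalised
Freedman–Gompf–Morrison–Walker lemma: for every `k`, every model circle `K₀ ⊂ ∂D_k ≅ #ᵏ(S¹ × S²)`,
every smooth embedding `e' : ℝ⁴ → S⁴` and every smooth proper disc `f'` in `S⁴ ∖ e'(D_k)` bounded by
`e' ∘ K₀` (`MMSW.IsSliceDiscInComplement k K₀ S⁴ e' f'`), every `w : MMSWRasmussen k K₀` satisfies
`s₋(K₀) ≤ 0 ≤ s₊(K₀)`.  This file PROVES the differential topology of the lemma and lands the item's
statement CONDITIONALLY on the one named fact it rests on: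

* `DcrGfgmw.exists_isModelSliceDisc_or_mirror` — **standardisation (Palais transfer + general
  position)**: a disc in `S⁴ ∖ e'(D_k)` bounded by `e' ∘ K₀`, for ANY smooth embedding `e'`, yields a
  MODEL slice disc (`MMSW.IsModelSliceDisc`, a smooth proper disc in `ℝ⁴ ∖ D_k`) for `K₀` or for its
  mirror `ρ ∘ K₀`: a point `q = e'(v)`, `‖v‖ > 2R`, off the disc (easy Sard,
  `exists_lt_norm_apply_notMem_range`); in the stereographic chart `σ` from `q` the thinned ball
  `σ ∘ e' ∘ (R • ballStretch 2)` and the round ball `R • ballStretch 2` are two discs of the connected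
  manifold `ℝ⁴`, so the tree's unoriented disc theorem of Palais–Cerf–Hirsch
  (`exists_diffeomorph_apply_disc_eq_or_reflect_of_model`) gives a diffeomorphism `Φ` of `ℝ⁴` with
  `Φ ∘ σ ∘ e' = id` or `= ρ` on `B̄(0, R) ⊇ D_k`, and `Φ ∘ σ ∘ f'` is the model disc;
* `DcrGfgmw.sMinus_nonpos_sPlus_nonneg_of_isSliceDiscInComplement`, `DcrGfgmw.gfgmw` — the window
  for data in any `N ≅ S⁴`, from MMSW Lemma 8.19 in the model (`MMSW.sMinus_nonpos_of_isModelSliceDisc`,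
  hypothesis `h19`) and its mirror (the window of `ρ ∘ K₀` is `(-s₊, -s₋)`, MMSW Prop. 8.8 (1));
* `DcrGfgmw_of_mmsw819 : MMSW.sMinus_nonpos_of_isModelSliceDisc → DcrGfgmw` — the route decl,
  conditional on MMSW Lemma 8.19 (Khovanov–Lee homology in `#ʳ(S¹ × S²)`, not in the tree).

References: Palais, Proc. AMS 11 (1960), Thm. B [Palais1960]; Hirsch, *Differential Topology*
(1976), Ch. 8 §3 Thm. 3.1 [HirschDT1976]; Manolescu–Marengon–Sarkar–Willis, Duke Math. J. 172 (2023),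
Lemma 8.19, Prop. 8.8 [ManolescuMarengonSarkarWillis2023]; Freedman–Gompf–Morrison–Walker, Quantum
Topol. 1 (2010), §1 [FreedmanGompfMorrisonWalker2010]; Milnor, *TDV* (1965), §3 [MilnorTDV1965].
-/

-- the registered namespace `Summit.SmoothPoincare4.SmoothPoincare4.Theorems` repeats a component
set_option linter.dupNamespace false

open scoped Manifold ContDiff Topology InnerProductSpace
open Function Set Metric Module
open Literature.Topology.FourManifolds Literature.Topology.FourManifolds.MMSW

noncomputable section

namespace Summit.SmoothPoincare4.SmoothPoincare4.Theorems

namespace DcrGfgmw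

/-! ### The model mirror `ρ(x₀,x₁,x₂,x₃) = (x₀,-x₁,x₂,x₃)` as a hyperplane reflection -/

/-- The model mirror preserves norms. [folklore] -/
theorem norm_modelMirror (p : EuclideanSpace ℝ (Fin 4)) : ‖modelMirror p‖ = ‖p‖ := by
  rw [EuclideanSpace.norm_eq, EuclideanSpace.norm_eq]
  simp [Fin.sum_univ_four]

/-- **The model mirror is a hyperplane reflection of negative determinant**: Mathlib's
`((ℝ ∙ e₁)ᗮ).reflection`, `e₁ = (0, 1, 0, 0)`, is a linear isometry `r` of `ℝ⁴` with `r = ρ`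
pointwise and `det r = (-1) ^ finrank (ℝ ∙ e₁) = -1 < 0` (`Submodule.det_reflection`) — the
reflection fed to the unoriented disc theorem. [folklore] -/
theorem exists_mirror_continuousLinearEquiv :
    ∃ r : EuclideanSpace ℝ (Fin 4) ≃L[ℝ] EuclideanSpace ℝ (Fin 4),
      (∀ p, r p = modelMirror p) ∧
        LinearMap.det (r.toLinearEquiv : EuclideanSpace ℝ (Fin 4) →ₗ[ℝ] EuclideanSpace ℝ (Fin 4))
          < 0 := by
  set u : EuclideanSpace ℝ (Fin 4) := EuclideanSpace.single (1 : Fin 4) (1 : ℝ) with hu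
  have hu0 : u ≠ 0 := by
    intro h
    have := congrArg (fun v : EuclideanSpace ℝ (Fin 4) => v 1) h
    simp [hu] at this
  refine ⟨((ℝ ∙ u)ᗮ).reflection.toContinuousLinearEquiv, fun p => ?_, ?_⟩
  · show ((ℝ ∙ u)ᗮ).reflection p = _
    rw [Submodule.reflection_orthogonal_apply, Submodule.reflection_singleton_apply]
    have hn : ‖u‖ = 1 := by simp [hu]
    have hip : ⟪u, p⟫_ℝ = p 1 := by simp [hu, EuclideanSpace.inner_single_left]
    rw [hn, hip]
    ext i
    fin_cases i <;> simp [hu, modelMirror, two_smul]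
  · have h := Submodule.det_reflection (K := (ℝ ∙ u)ᗮ)
    rw [Submodule.orthogonal_orthogonal, finrank_span_singleton hu0, pow_one] at h
    have h' : LinearMap.det ((((ℝ ∙ u)ᗮ).reflection.toContinuousLinearEquiv).toLinearEquiv :
        EuclideanSpace ℝ (Fin 4) →ₗ[ℝ] EuclideanSpace ℝ (Fin 4)) = -1 := h
    rw [h']
    norm_num

/-! ### The model handlebody is bounded -/

/-- **`D_k ⊆ B̄(0, 40(k+1) + 1)`**: on `D_k = {G_k ≤ 1}` one has `|z| ≤ 40(k+1)` and `|w| ≤ 1`.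
[folklore] -/
theorem norm_le_of_mem_modelHandlebody {k : ℕ} {x : EuclideanSpace ℝ (Fin 4)}
    (hx : x ∈ modelHandlebody k) : ‖x‖ ≤ 40 * ((k : ℝ) + 1) + 1 := by
  obtain ⟨-, hle⟩ := hx
  have hS : 0 ≤ ∑ j : Fin k, 1 / holeTerm k j x :=
    Finset.sum_nonneg fun j _ => by unfold holeTerm; positivity
  have hA : 0 < 40 * ((k : ℝ) + 1) := by positivity
  unfold levelFun at hle
  have h2 : 0 ≤ ((x 0) ^ 2 + (x 1) ^ 2) / (40 * ((k : ℝ) + 1)) ^ 2 := by positivity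
  have h1 : ((x 0) ^ 2 + (x 1) ^ 2) / (40 * ((k : ℝ) + 1)) ^ 2 ≤ 1 := by
    nlinarith [sq_nonneg (x 2), sq_nonneg (x 3)]
  rw [div_le_one (by positivity)] at h1
  have h3 : (x 2) ^ 2 + (x 3) ^ 2 ≤ 1 := by nlinarith [sq_nonneg (x 2), sq_nonneg (x 3)]
  have hsq : ‖x‖ ^ 2 ≤ (40 * ((k : ℝ) + 1) + 1) ^ 2 := by
    rw [EuclideanSpace.norm_sq_eq]
    simp only [Real.norm_eq_abs, sq_abs, Fin.sum_univ_four]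
    nlinarith
  exact (pow_le_pow_iff_left₀ (norm_nonneg x) (by positivity) two_ne_zero).1 hsq

/-! ### Transport of slice data along smooth embeddings of 4-manifolds -/

/-- **Slice data in the complement of the dotted handlebody are carried along smooth embeddings
of 4-manifolds** `J : X → Y`: `(J ∘ e, J ∘ f)` is again a datum — word for word the tree's
`Knot.IsSliceDiscIn.comp_isSmoothEmbedding` with the closed unit ball replaced by `D_k`. [folklore] -/
theorem isSliceDiscInComplement_comp {X : Type*} [TopologicalSpace X]
    [ChartedSpace (EuclideanSpace ℝ (Fin 4)) X] [IsManifold (𝓡 4) ∞ X] {Y : Type*}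
    [TopologicalSpace Y] [ChartedSpace (EuclideanSpace ℝ (Fin 4)) Y] [IsManifold (𝓡 4) ∞ Y]
    {k : ℕ} {K : (Metric.sphere (0 : EuclideanSpace ℝ (Fin 2)) 1) → EuclideanSpace ℝ (Fin 4)}
    {e : EuclideanSpace ℝ (Fin 4) → X} {f : EuclideanSpace ℝ (Fin 2) → X}
    (h : IsSliceDiscInComplement k K X e f) {J : X → Y}
    (hJ : Manifold.IsSmoothEmbedding (𝓡 4) (𝓡 4) ∞ J) :
    IsSliceDiscInComplement k K Y (J ∘ e) (J ∘ f) := by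
  obtain ⟨he, hf, hinj, hmf, hproper, hbdry⟩ := h
  refine ⟨IsSmoothEmbedding.comp_of_isOpen_range hJ he (isOpen_range_of_isSmoothEmbedding_disc he),
    hJ.contMDiff.comp hf, hJ.isEmbedding.injective.comp_injOn hinj, fun x hx => ?_,
    fun x hx => ?_, fun x => by rw [comp_apply, hbdry x]; rfl⟩
  · have h1 : MDifferentiableAt (𝓡 2) (𝓡 4) f x := (hf x).mdifferentiableAt (by simp)
    have h2 : MDifferentiableAt (𝓡 4) (𝓡 4) J (f x) :=
      (hJ.contMDiff (f x)).mdifferentiableAt (by simp)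
    rw [mfderiv_comp x h2 h1]
    exact (Manifold.IsImmersionAt.mfderiv_injective (hJ.isImmersion.isImmersionAt (f x))
      (by simp)).comp (hmf x hx)
  · rintro ⟨v, hv, hfv⟩
    exact hproper x hx ⟨v, hv, hJ.isEmbedding.injective hfv⟩

/-- Slice data in the complement of `D_k` are carried along diffeomorphisms. [folklore] -/
theorem isSliceDiscInComplement_comp_diffeomorph {X : Type*} [TopologicalSpace X]
    [ChartedSpace (EuclideanSpace ℝ (Fin 4)) X] [IsManifold (𝓡 4) ∞ X] {Y : Type*}
    [TopologicalSpace Y] [ChartedSpace (EuclideanSpace ℝ (Fin 4)) Y] [IsManifold (𝓡 4) ∞ Y]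
    {k : ℕ} {K : (Metric.sphere (0 : EuclideanSpace ℝ (Fin 2)) 1) → EuclideanSpace ℝ (Fin 4)}
    {e : EuclideanSpace ℝ (Fin 4) → X} {f : EuclideanSpace ℝ (Fin 2) → X}
    (h : IsSliceDiscInComplement k K X e f) (Φ : X ≃ₘ⟮𝓡 4, 𝓡 4⟯ Y) :
    IsSliceDiscInComplement k K Y (Φ ∘ e) (Φ ∘ f) :=
  isSliceDiscInComplement_comp h Φ.isSmoothEmbedding'

/-! ### Standardisation: a disc in `S⁴ ∖ e(D_k)` gives a model slice disc, up to the mirror -/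

section Sphere

/-- **Standardisation of slice data in `S⁴` (Palais).** Let `e : ℝ⁴ → S⁴` be any smooth embedding
and `f` a smooth proper disc in `S⁴ ∖ e(D_k)` bounded by `e ∘ K`, `K ⊂ ∂D_k`
(`MMSW.IsSliceDiscInComplement k K S⁴ e f`). Then `K`, or its mirror image `ρ ∘ K`, bounds a MODEL
slice disc — a smooth proper disc in `ℝ⁴ ∖ D_k` (`MMSW.IsModelSliceDisc`). Proof: by the dimension
count (easy Sard, `exists_lt_norm_apply_notMem_range`) some point `q = e v`, `‖v‖ > 2R`, is missed
by `f`; in the stereographic chart `σ` from `q` (a diffeomorphism `S⁴ ∖ {q} ≅ ℝ⁴`) the ball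
`σ ∘ e` (thinned to radius `2R` by `ballStretch`) and the round ball are two discs of the connected
manifold `ℝ⁴`, so the unoriented disc theorem of Palais–Cerf–Hirsch
(`exists_diffeomorph_apply_disc_eq_or_reflect_of_model`, Palais 1960 Thm. B, Hirsch 1976 Ch. 8 §3
Thm. 3.1) gives a diffeomorphism `Φ` of `ℝ⁴` with `Φ ∘ σ ∘ e = id` or `= ρ` on `B̄(0, R) ⊇ D_k`;
then `Φ ∘ σ ∘ f` is the required disc (`ρ` preserves `D_k`).
[cite: Palais1960, Thm. B] [cite: HirschDT1976, Ch. 8 §3, Thm. 3.1] -/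
theorem exists_isModelSliceDisc_or_mirror {k : ℕ}
    {K : (Metric.sphere (0 : EuclideanSpace ℝ (Fin 2)) 1) → EuclideanSpace ℝ (Fin 4)}
    (hK : ∀ t, K t ∈ modelBoundary k)
    {e : EuclideanSpace ℝ (Fin 4) → (Metric.sphere (0 : EuclideanSpace ℝ (Fin 5)) 1)}
    {f : EuclideanSpace ℝ (Fin 2) → (Metric.sphere (0 : EuclideanSpace ℝ (Fin 5)) 1)}
    (h : IsSliceDiscInComplement k K (Metric.sphere (0 : EuclideanSpace ℝ (Fin 5)) 1) e f) :
    ∃ g : EuclideanSpace ℝ (Fin 2) → EuclideanSpace ℝ (Fin 4),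
      IsModelSliceDisc k K g ∨ IsModelSliceDisc k (modelMirror ∘ K) g := by
  haveI : Fact (finrank ℝ (EuclideanSpace ℝ (Fin (4 + 1))) = 4 + 1) := ⟨finrank_euclideanSpace_fin⟩
  obtain ⟨he, hf, hinj, hmf, hproper, hbdry⟩ := h
  have hn : (∞ : ℕ∞ω) ≠ 0 := by simp
  -- the radius `R = 40(k+1) + 1` of a round ball containing `D_k`
  obtain ⟨R, hRdef⟩ : ∃ R : ℝ, R = 40 * ((k : ℝ) + 1) + 1 := ⟨_, rfl⟩
  have hR : 0 < R := by rw [hRdef]; positivity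
  have hDR : ∀ x : EuclideanSpace ℝ (Fin 4), x ∈ modelHandlebody k → ‖x‖ ≤ R := fun x hx => by
    rw [hRdef]; exact norm_le_of_mem_modelHandlebody hx
  -- Step 1: a point `q = e v` far out on the ball and off the disc
  obtain ⟨v, hv, hvq⟩ := exists_lt_norm_apply_notMem_range (m := 2) (n := 4)
    (X := (Metric.sphere (0 : EuclideanSpace ℝ (Fin 5)) 1)) (by norm_num) he hf (2 * R)
  have hfq : ∀ x, f x ≠ e v := fun x hx => hvq ⟨x, hx⟩
  have heq : ∀ x : EuclideanSpace ℝ (Fin 4), ‖x‖ < 2 * R → e x ≠ e v := fun x hx hex => by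
    have hxv : x = v := he.isEmbedding.injective hex
    rw [hxv] at hx
    exact lt_asymm hx hv
  -- Step 2: the stereographic chart from `q`
  set σ : OpenPartialHomeomorph (Metric.sphere (0 : EuclideanSpace ℝ (Fin 5)) 1)
    (EuclideanSpace ℝ (Fin 4)) := stereographic' 4 (e v) with hσdef
  have hσatlas : σ ∈ atlas (EuclideanSpace ℝ (Fin 4)) (Metric.sphere (0 : EuclideanSpace ℝ (Fin 5)) 1) :=
    stereographic'_mem_atlas (e v)
  have hσc : ContMDiffOn (𝓡 4) (𝓡 4) ∞ σ σ.source :=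
    contMDiffOn_of_mem_maximalAtlas (IsManifold.subset_maximalAtlas hσatlas)
  have hσd : σ.MDifferentiable (𝓡 4) (𝓡 4) := mdifferentiable_of_mem_atlas hσatlas
  have memσ : ∀ {p : (Metric.sphere (0 : EuclideanSpace ℝ (Fin 5)) 1)}, p ≠ e v → p ∈ σ.source :=
    fun hp => by rw [hσdef, stereographic'_source]; exact hp
  have hσAt : ∀ {p : (Metric.sphere (0 : EuclideanSpace ℝ (Fin 5)) 1)}, p ≠ e v →
      MDifferentiableAt (𝓡 4) (𝓡 4) σ p := fun hp =>
    ((hσc _ (memσ hp)).contMDiffAt (σ.open_source.mem_nhds (memσ hp))).mdifferentiableAt hn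
  -- Step 3: the round disc `s = R • ballStretch 2` (`= R •` on the unit ball) and `F = σ ∘ e ∘ s`
  obtain ⟨s, hsdef⟩ : ∃ s : EuclideanSpace ℝ (Fin 4) → EuclideanSpace ℝ (Fin 4),
      s = fun y => R • ballStretch 2 y := ⟨_, rfl⟩
  have hs_smooth : ContDiff ℝ ∞ s := hsdef ▸ (contDiff_ballStretch one_lt_two).const_smul _
  have hs_norm : ∀ y, ‖s y‖ < 2 * R := fun y => by
    rw [hsdef, norm_smul, Real.norm_of_nonneg hR.le]
    have := norm_ballStretch_lt one_lt_two y
    nlinarith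
  have hs_one : ∀ y : EuclideanSpace ℝ (Fin 4), ‖y‖ ≤ 1 → s y = R • y := fun y hy => by
    rw [hsdef]
    simp only [ballStretch_eq_self one_lt_two hy]
  have hs_inj : Injective s := fun y₁ y₂ hy => by
    rw [hsdef] at hy
    exact injective_ballStretch one_lt_two (smul_right_injective _ hR.ne' hy)
  have hs_fderiv : ∀ y, Injective (fderiv ℝ s y) := fun y => by
    have hd : DifferentiableAt ℝ (ballStretch 2 : EuclideanSpace ℝ (Fin 4) → EuclideanSpace ℝ (Fin 4))
        y := (contDiff_ballStretch one_lt_two).differentiable (by simp) y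
    have : fderiv ℝ s y = R • fderiv ℝ (ballStretch 2) y := by
      rw [hsdef]; exact fderiv_const_smul hd R
    rw [this]
    intro a b hab
    apply injective_fderiv_ballStretch one_lt_two y
    have hab' : R • fderiv ℝ (ballStretch 2) y a = R • fderiv ℝ (ballStretch 2) y b := hab
    exact smul_right_injective _ hR.ne' hab'
  have hs_emb : Manifold.IsSmoothEmbedding 𝓘(ℝ, EuclideanSpace ℝ (Fin 4))
      𝓘(ℝ, EuclideanSpace ℝ (Fin 4)) ∞ s :=
    isSmoothEmbedding_of_injective_fderiv hs_smooth hs_inj hs_fderiv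
  have hes : ∀ y, e (s y) ∈ σ.source := fun y => memσ (heq _ (hs_norm y))
  have hes_smooth : ContMDiff 𝓘(ℝ, EuclideanSpace ℝ (Fin 4)) (𝓡 4) ∞ (e ∘ s) :=
    he.contMDiff.comp hs_smooth.contMDiff
  obtain ⟨F, hFdef⟩ : ∃ F : EuclideanSpace ℝ (Fin 4) → EuclideanSpace ℝ (Fin 4), F = σ ∘ (e ∘ s) :=
    ⟨_, rfl⟩
  have hF_apply : ∀ y, F y = σ (e (s y)) := fun y => by rw [hFdef]; rfl
  have hF_smooth : ContMDiff 𝓘(ℝ, EuclideanSpace ℝ (Fin 4)) 𝓘(ℝ, EuclideanSpace ℝ (Fin 4)) ∞ F :=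
    hFdef ▸ hσc.comp_contMDiff hes_smooth hes
  have hF_inj : Injective F := fun y₁ y₂ hy => by
    rw [hF_apply, hF_apply] at hy
    exact hs_inj (he.isEmbedding.injective (σ.injOn (hes y₁) (hes y₂) hy))
  have hF_fderiv : ∀ y, Injective (fderiv ℝ F y) := fun y => by
    rw [← mfderiv_eq_fderiv]
    have h1 : MDifferentiableAt 𝓘(ℝ, EuclideanSpace ℝ (Fin 4)) (𝓡 4) (e ∘ s) y :=
      (hes_smooth y).mdifferentiableAt hn
    have h3 : MDifferentiableAt 𝓘(ℝ, EuclideanSpace ℝ (Fin 4)) 𝓘(ℝ, EuclideanSpace ℝ (Fin 4)) s y :=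
      (hs_smooth.contMDiff y).mdifferentiableAt hn
    have h4 : MDifferentiableAt 𝓘(ℝ, EuclideanSpace ℝ (Fin 4)) (𝓡 4) e (s y) :=
      (he.contMDiff (s y)).mdifferentiableAt hn
    have h2 : MDifferentiableAt (𝓡 4) (𝓡 4) σ ((e ∘ s) y) := hσAt (heq (s y) (hs_norm y))
    rw [hFdef, mfderiv_comp y h2 h1]
    refine injective_continuousLinearMap_comp (hσd.mfderiv_injective (hes y)) ?_
    rw [mfderiv_comp y h4 h3]
    refine injective_continuousLinearMap_comp
      (Manifold.IsImmersionAt.mfderiv_injective (he.isImmersion.isImmersionAt (s y)) hn) ?_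
    rw [mfderiv_eq_fderiv]
    exact hs_fderiv y
  have hF_emb : Manifold.IsSmoothEmbedding 𝓘(ℝ, EuclideanSpace ℝ (Fin 4))
      𝓘(ℝ, EuclideanSpace ℝ (Fin 4)) ∞ F :=
    isSmoothEmbedding_of_injective_fderiv (contMDiff_iff_contDiff.1 hF_smooth) hF_inj hF_fderiv
  -- Step 4: the unoriented disc theorem in the connected manifold `ℝ⁴`, with the mirror `ρ`
  obtain ⟨r, hr, hdet⟩ := exists_mirror_continuousLinearEquiv
  obtain ⟨Φ, hΦ⟩ := exists_diffeomorph_apply_disc_eq_or_reflect_of_model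
    (M := EuclideanSpace ℝ (Fin 4)) (I := 𝓘(ℝ, EuclideanSpace ℝ (Fin 4)))
    (by rw [finrank_euclideanSpace_fin]; norm_num) hF_emb hs_emb r hdet
  -- Step 5: in either case `Φ ∘ σ ∘ e` is, on `B̄(0, R) ⊇ D_k`, an involution `L ∈ {id, ρ}`
  obtain ⟨L, hLL, hLD, hLid, hL⟩ : ∃ L : EuclideanSpace ℝ (Fin 4) → EuclideanSpace ℝ (Fin 4),
      (∀ x, L (L x) = x) ∧ (∀ x, L x ∈ modelHandlebody k ↔ x ∈ modelHandlebody k) ∧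
      (L = id ∨ L = modelMirror) ∧ ∀ x : EuclideanSpace ℝ (Fin 4), ‖x‖ ≤ R → Φ (σ (e x)) = L x := by
    have hsmall : ∀ x : EuclideanSpace ℝ (Fin 4), ‖x‖ ≤ R → ‖R⁻¹ • x‖ ≤ 1 := fun x hx => by
      rw [norm_smul, norm_inv, Real.norm_of_nonneg hR.le]
      exact (inv_mul_le_iff₀ hR).2 (by simpa using hx)
    rcases hΦ with hA | hB
    · refine ⟨id, fun _ => rfl, fun _ => Iff.rfl, Or.inl rfl, fun x hx => ?_⟩
      have := hA _ (hsmall x hx)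
      rwa [hF_apply, hs_one _ (hsmall x hx), smul_smul, mul_inv_cancel₀ hR.ne', one_smul] at this
    · refine ⟨modelMirror, modelMirror_modelMirror, modelMirror_mem_modelHandlebody_iff,
        Or.inr rfl, fun x hx => ?_⟩
      have hx' : ‖modelMirror x‖ ≤ R := by rwa [norm_modelMirror]
      have := hB _ (hsmall _ hx')
      rw [map_smul, hr, modelMirror_modelMirror, hF_apply, hs_one _ (hsmall x hx), smul_smul,
        mul_inv_cancel₀ hR.ne', one_smul, hs_one _ (hsmall _ hx'), smul_smul,
        mul_inv_cancel₀ hR.ne', one_smul] at this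
      exact this
  -- Step 6: the disc `Φ ∘ σ ∘ f`
  have hfs : ∀ x, f x ∈ σ.source := fun x => memσ (hfq x)
  have key : IsModelSliceDisc k (L ∘ K) (fun x => Φ (σ (f x))) := by
    refine ⟨Φ.contMDiff.comp (hσc.comp_contMDiff hf hfs), fun x₁ hx₁ x₂ hx₂ hx =>
      hinj hx₁ hx₂ (σ.injOn (hfs x₁) (hfs x₂) (Φ.injective hx)), fun x hx => ?_,
      fun x hx hmem => ?_, fun t => ?_⟩
    · have h1 : MDifferentiableAt (𝓡 2) (𝓡 4) f x := (hf x).mdifferentiableAt hn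
      have h2 : MDifferentiableAt (𝓡 4) (𝓡 4) σ (f x) := hσAt (hfq x)
      have h3 : MDifferentiableAt 𝓘(ℝ, EuclideanSpace ℝ (Fin 4)) 𝓘(ℝ, EuclideanSpace ℝ (Fin 4)) Φ
          ((σ ∘ f) x) := (Φ.contMDiff _).mdifferentiableAt hn
      have h12 : MDifferentiableAt (𝓡 2) (𝓡 4) (σ ∘ f) x := h2.comp x h1
      have hΦ' : Injective (mfderiv 𝓘(ℝ, EuclideanSpace ℝ (Fin 4)) 𝓘(ℝ, EuclideanSpace ℝ (Fin 4)) Φ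
          ((σ ∘ f) x)) := by
        have := (Φ.mfderivToContinuousLinearEquiv hn ((σ ∘ f) x)).injective
        rwa [← ContinuousLinearEquiv.coe_coe, Diffeomorph.mfderivToContinuousLinearEquiv_coe] at this
      rw [show (fun x => Φ (σ (f x))) = Φ ∘ (σ ∘ f) from rfl, mfderiv_comp x h3 h12]
      refine injective_continuousLinearMap_comp hΦ' ?_
      rw [mfderiv_comp x h2 h1]
      exact injective_continuousLinearMap_comp (hσd.mfderiv_injective (hfs x)) (hmf x hx)
    · have hyD : L (Φ (σ (f x))) ∈ modelHandlebody k := (hLD _).2 hmem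
      have hy : ‖L (Φ (σ (f x)))‖ ≤ R := hDR _ hyD
      have h1 : Φ (σ (e (L (Φ (σ (f x)))))) = Φ (σ (f x)) := by rw [hL _ hy, hLL]
      have h3 : e (L (Φ (σ (f x)))) = f x :=
        σ.injOn (memσ (heq _ (by linarith))) (hfs x) (Φ.injective h1)
      exact hproper x hx ⟨_, hyD, h3⟩
    · show Φ (σ (f t)) = L (K t)
      rw [hbdry t, hL _ (hDR _ (modelBoundary_subset_modelHandlebody (hK t)))]
  refine ⟨fun x => Φ (σ (f x)), ?_⟩
  rcases hLid with rfl | rfl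
  · exact Or.inl key
  · exact Or.inr key

end Sphere

/-- **Standardisation of slice data in a standard sphere `N ≅ S⁴`** (any carrier type and atlas):
transport along the diffeomorphism (`isSliceDiscInComplement_comp_diffeomorph`), then
`exists_isModelSliceDisc_or_mirror`. [cite: Palais1960, Thm. B] -/
theorem exists_isModelSliceDisc_or_mirror_of_diffeomorph {N : Type*} [TopologicalSpace N]
    [ChartedSpace (EuclideanSpace ℝ (Fin 4)) N] [IsManifold (𝓡 4) ∞ N] {k : ℕ}
    {K : (Metric.sphere (0 : EuclideanSpace ℝ (Fin 2)) 1) → EuclideanSpace ℝ (Fin 4)}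
    (hK : ∀ t, K t ∈ modelBoundary k)
    (Θ : N ≃ₘ⟮𝓡 4, 𝓡 4⟯ (Metric.sphere (0 : EuclideanSpace ℝ (Fin 5)) 1))
    {e : EuclideanSpace ℝ (Fin 4) → N} {f : EuclideanSpace ℝ (Fin 2) → N}
    (h : IsSliceDiscInComplement k K N e f) :
    ∃ g : EuclideanSpace ℝ (Fin 2) → EuclideanSpace ℝ (Fin 4),
      IsModelSliceDisc k K g ∨ IsModelSliceDisc k (modelMirror ∘ K) g :=
  exists_isModelSliceDisc_or_mirror hK (isSliceDiscInComplement_comp_diffeomorph h Θ)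

/-! ### The GFGMW lemma: the slice window `s₋(K) ≤ 0 ≤ s₊(K)` -/

/-- **The GFGMW lemma (generalised Freedman–Gompf–Morrison–Walker), model-knot form.** Let
`K ⊂ ∂D_k ≅ #ᵏ(S¹ × S²)` be a null-homologous model knot with Manolescu–Marengon–Sarkar–Willis
invariants `w = (s₋(K), s₊(K))`, and suppose that for SOME smooth embedding `e : ℝ⁴ → N` of the
dotted handlebody into a smooth 4-manifold `N` diffeomorphic to `S⁴` the circle `e ∘ K` bounds a
smooth proper disc in `N ∖ e(D_k)`. Then `s₋(K) ≤ 0 ≤ s₊(K)`. Proof: by the standardisation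
theorem (Palais' disc theorem, `exists_isModelSliceDisc_or_mirror_of_diffeomorph`) `K` or `ρ ∘ K`
bounds a model slice disc in `ℝ⁴ ∖ D_k ⊂ S⁴ ∖ D_k° ≅ ♮ᵏ(B² × S²)`; MMSW Lemma 8.19 (the named fact
`MMSW.sMinus_nonpos_of_isModelSliceDisc`, hypothesis `h19`) and its mirror
(`MMSWRasmussen.sMinus_nonpos_sPlus_nonneg`) give the window for `K`, resp. for `ρ ∘ K` — and the
window of `ρ ∘ K`, `(-s₊(K), -s₋(K))` (MMSW Prop. 8.8 (1), `MMSWRasmussen.modelMirror`), is the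
same condition. CONDITIONAL on `h19` (MMSW Lemma 8.19, Khovanov–Lee homology in `#ʳ(S¹ × S²)`).
[cite: ManolescuMarengonSarkarWillis2023, Lemma 8.19 and Prop. 8.8 (1)]
[cite: FreedmanGompfMorrisonWalker2010, §1] [cite: Palais1960, Thm. B] -/
theorem sMinus_nonpos_sPlus_nonneg_of_isSliceDiscInComplement
    (h19 : sMinus_nonpos_of_isModelSliceDisc) {N : Type*} [TopologicalSpace N]
    [ChartedSpace (EuclideanSpace ℝ (Fin 4)) N] [IsManifold (𝓡 4) ∞ N]
    (Θ : N ≃ₘ⟮𝓡 4, 𝓡 4⟯ (Metric.sphere (0 : EuclideanSpace ℝ (Fin 5)) 1)) {k : ℕ}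
    {K : (Metric.sphere (0 : EuclideanSpace ℝ (Fin 2)) 1) → EuclideanSpace ℝ (Fin 4)}
    (w : MMSWRasmussen k K) {e : EuclideanSpace ℝ (Fin 4) → N} {f : EuclideanSpace ℝ (Fin 2) → N}
    (h : IsSliceDiscInComplement k K N e f) : w.sMinus ≤ 0 ∧ 0 ≤ w.sPlus := by
  obtain ⟨g, hg | hg⟩ :=
    exists_isModelSliceDisc_or_mirror_of_diffeomorph (fun t => w.isModelKnot.mem t) Θ h
  · exact w.sMinus_nonpos_sPlus_nonneg h19 hg
  · have := w.modelMirror.sMinus_nonpos_sPlus_nonneg h19 hg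
    simp only [MMSWRasmussen.sMinus_modelMirror, MMSWRasmussen.sPlus_modelMirror] at this
    omega

/-- **The GFGMW lemma in the quantifier shape of the route's items** (`DcrGap`'s no-disc clause
ranges over all `N ≅ S⁴` given by `Nonempty (Diffeomorph …)`): for every `k`, model circle
`K₀ ⊂ ∂D_k`, smooth `N ≅ S⁴` and `MMSW.IsSliceDiscInComplement k K₀ N e' f'` datum, all MMSW
invariants of `K₀` satisfy `s₋(K₀) ≤ 0 ≤ s₊(K₀)` — conditional on MMSW Lemma 8.19 (`h19`).
[cite: ManolescuMarengonSarkarWillis2023, Lemma 8.19] [cite: FreedmanGompfMorrisonWalker2010, §1] -/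
theorem gfgmw (h19 : sMinus_nonpos_of_isModelSliceDisc) (k : ℕ)
    (K : (Metric.sphere (0 : EuclideanSpace ℝ (Fin 2)) 1) → EuclideanSpace ℝ (Fin 4))
    (N : Type*) [TopologicalSpace N] [ChartedSpace (EuclideanSpace ℝ (Fin 4)) N]
    [IsManifold (𝓡 4) ∞ N]
    (hN : Nonempty (N ≃ₘ⟮𝓡 4, 𝓡 4⟯ (Metric.sphere (0 : EuclideanSpace ℝ (Fin 5)) 1)))
    (e : EuclideanSpace ℝ (Fin 4) → N) (f : EuclideanSpace ℝ (Fin 2) → N)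
    (h : IsSliceDiscInComplement k K N e f) (w : MMSWRasmussen k K) :
    w.sMinus ≤ 0 ∧ 0 ≤ w.sPlus := by
  obtain ⟨Θ⟩ := hN
  exact sMinus_nonpos_sPlus_nonneg_of_isSliceDiscInComplement h19 Θ w h

end DcrGfgmw

/-- **Item stmt-SmoothPoincare4-16153 (`DottedCircleRasmussen.DcrGfgmw`), conditionally on MMSW
Lemma 8.19.** The GFGMW window in the literal `S⁴`: for every `k`, model circle `K₀ ⊂ ∂D_k`, smooth
embedding `e' : ℝ⁴ → S⁴` and slice disc `f'` for `e' ∘ K₀` in `S⁴ ∖ e'(D_k)`, every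
`w : MMSWRasmussen k K₀` has `s₋ ≤ 0 ≤ s₊`.  Everything but the model genus bound is proved above
(Palais transfer `DcrGfgmw.exists_isModelSliceDisc_or_mirror`; here `N = S⁴`, `Diffeomorph.refl`,
via `DcrGfgmw.gfgmw`); the hypothesis `h19` is the named fact `MMSW.sMinus_nonpos_of_isModelSliceDisc` — MMSW Lemma 8.19 for
a knot bounding a disc in `♮ᵏ(B² × S²)`, which rests on Khovanov–Lee homology in `#ʳ(S¹ × S²)` and is
not proved in the tree — so this is a CONDITIONAL result: the item closes when that fact is
discharged (or is restated with it as hypothesis).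
[cite: ManolescuMarengonSarkarWillis2023, Lemma 8.19 and Prop. 8.8 (1)] [cite: Palais1960, Thm. B]
[cite: FreedmanGompfMorrisonWalker2010, §1] -/
theorem DcrGfgmw_of_mmsw819
    (h19 : Literature.Topology.FourManifolds.MMSW.sMinus_nonpos_of_isModelSliceDisc) :
    Summit.SmoothPoincare4.SmoothPoincare4.Theses.DottedCircleRasmussen.DcrGfgmw := by
  unfold Summit.SmoothPoincare4.SmoothPoincare4.Theses.DottedCircleRasmussen.DcrGfgmw
  intro k K e f h w
  exact DcrGfgmw.gfgmw h19 k K _ ⟨Diffeomorph.refl _ _ _⟩ e f h w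

end Summit.SmoothPoincare4.SmoothPoincare4.Theorems

end
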